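import Summits.Ventures.HodgeRepro.Night3WeilModel

/-!
# Non-vacuity of the Weil model: the trivial instance

Blind re-derivation cell `pub-hodge-repro`, seat `night-3` (gen 2).  Imports `Night3WeilModel`.  Namespace
`HodgeRepro.Night3.WeilModel`.

A structure whose fields were jointly unsatisfiable would make `WeilModel.alg_of_faces` true for nothing.  This file
exhibits, for every field extension `K ⊆ L`, every non-empty index set `ι` and every index monoid `A`, the TRIVIAL Weil
model — `H a = K`, the Künneth map `x ↦ 1 ⊗ x`, every line `1 ⊗ 1`, `W a = Alg a = ⊤`, `Q a = ` multiplication — and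
checks the five fields `hW` / `hℓ` / `hmul` / `hproj` / `hQ` for it (`trivial`, `nonempty`).  It is a consistency check only:
in it every Weil space is algebraic by fiat, and `alg_of_faces` says nothing.  Nothing here closes S4; no sealed file is
touched; no Tier-2 item depends on this file.
-/

set_option autoImplicit false

open TensorProduct

namespace HodgeRepro.Night3.WeilModel

universe uK

variable (K : Type uK) (L : Type*) [Field K] [Field L] [Algebra K L] (ι : Type*) [Nonempty ι] (A : Type*)
  [AddCommMonoid A]

/-- In `L ⊗[K] K` every pure tensor is a multiple of `1 ⊗ 1`. -/
theorem tmul_eq_smul_one_tmul_one (a : L) (b : K) :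
    a ⊗ₜ[K] b = (a * algebraMap K L b) • ((1 : L) ⊗ₜ[K] (1 : K)) := by
  rw [TensorProduct.smul_tmul', smul_eq_mul, mul_one]
  conv_lhs => rw [← mul_one b, ← smul_eq_mul, TensorProduct.tmul_smul, TensorProduct.smul_tmul',
    Algebra.smul_def, mul_comm]

/-- The span of `1 ⊗ 1` is all of `L ⊗[K] K`. -/
theorem span_one_tmul_one_eq_top :
    Submodule.span L (Set.range fun _ : ι => (1 : L) ⊗ₜ[K] (1 : K)) = ⊤ := by
  rw [eq_top_iff]
  rintro x -
  induction x using TensorProduct.induction_on with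
  | zero => exact Submodule.zero_mem _
  | tmul a b =>
    rw [tmul_eq_smul_one_tmul_one K L a b]
    refine Submodule.smul_mem _ _ ?_
    exact Submodule.subset_span (Set.mem_range_self (Classical.arbitrary ι))
  | add x y hx hy => exact Submodule.add_mem _ hx hy

/-- **The trivial Weil model**: `H a = K`, `κ x = 1 ⊗ x`, every line `1 ⊗ 1`, `W = Alg = ⊤`, `Q = ` multiplication. -/
noncomputable def trivial : WeilModel.{uK} K L ι A where
  H _ := K
  acg _ := inferInstance
  mod _ := inferInstance
  κ _ _ := (TensorProduct.lid K K).symm.toLinearMap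
  ℓ _ _ := (1 : L) ⊗ₜ[K] (1 : K)
  W _ := ⊤
  Alg _ := ⊤
  Q _ := LinearMap.mul K K
  hW _ := by rw [Submodule.baseChange_top, span_one_tmul_one_eq_top]
  hℓ _ _ _ := by
    rw [LinearMap.baseChange_tmul, LinearEquiv.coe_coe, TensorProduct.lid_symm_apply,
      LemmaP.distribBaseChange_symm_tmul, one_mul]
  hmul _ _ := le_top
  hproj _ _ _ _ := le_top
  hQ := fun _ _ _ => Exists.intro (Classical.arbitrary ι) (by simp [LinearMap.BilinForm.baseChange_tmul])

/-- **Non-vacuity**: for every `K ⊆ L`, non-empty `ι` and `A` there is a Weil model. -/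
theorem nonempty : Nonempty (WeilModel.{uK} K L ι A) := ⟨trivial K L ι A⟩

end HodgeRepro.Night3.WeilModel
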